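import Summits.RiemannHypothesis.RiemannHypothesis.Theorems.SoloInformedDoubleLogLaw
import Summits.RiemannHypothesis.RiemannHypothesis.Theorems.SoloInformedGroundStateDecay2
import Literature.NumberTheory.LFunctions.WeilWindowSuzukiContinuityProofs
import HarnessLib

/-!
# The two-sided size law of the Weil ground energy under RH (soloist, capstone of §2k)

Sorry-free.  `ε(a) = weilGroundEnergy a` is the infimum of `Re W(g ⋆ g̃)` over unit Weil tests
on `[−a, a]`.  Unconditionally `ε(a) ≤ C exp(−c e^{2a})` for `a ≥ 1` (T2,
`weilGroundEnergy_exp_exp_decay`); under RH `ε(a) ≥ exp(−exp(A a))` for `a ≥ 1` (E3,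
`weilQuadratic_re_ge_exp_neg_exp_of_riemannHypothesis`).  This file states the combination in the
form the soloist's report quotes:

* `exp_neg_exp_le_weilGroundEnergy_of_riemannHypothesis` — RH ⟹ `∃ A > 0, ∀ a ≥ 1,
  exp(−exp(A a)) ≤ ε(a)`;
* `weilGroundEnergy_two_sided_of_riemannHypothesis` — RH ⟹ both bounds at once;
* `log_log_inv_weilGroundEnergy_of_riemannHypothesis` — **RH ⟹ `2a − K ≤ log log (1/ε(a)) ≤ A a`
  for all `a ≥ a₀`**: the double logarithm of the inverse ground energy grows linearly in the
  window, with slope between `2` and `A`.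

The slope `2` of the upper law is sharp for the soloist's trial functions; closing the gap
between `2` and `A` on the lower side is the open quantitative question (the kernel constant `A` is
explicit but very large).  Nothing here bears on the sign of `ε(a)` without RH.
-/

noncomputable section

open Real Set MeasureTheory Literature.NumberTheory.LFunctions

namespace Summit.RiemannHypothesis.RiemannHypothesis.Theorems

/-- **RH ⟹ the double-exponential lower law for the ground energy**: there is `A > 0` with
`exp(−exp(A a)) ≤ ε(a)` for every `a ≥ 1`. -/
theorem exp_neg_exp_le_weilGroundEnergy_of_riemannHypothesis (hRH : _root_.RiemannHypothesis) :
    ∃ A : ℝ, 0 < A ∧ ∀ a : ℝ, 1 ≤ a →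
      Real.exp (-Real.exp (A * a)) ≤ weilGroundEnergy a := by
  obtain ⟨A, hA, h⟩ := weilQuadratic_re_ge_exp_neg_exp_of_riemannHypothesis hRH
  exact ⟨A, hA, fun a ha ↦ le_weilGroundEnergy_of_forall (by linarith) (h a ha)⟩

/-- **RH ⟹ the two-sided size law**: `exp(−exp(A a)) ≤ ε(a) ≤ C exp(−c e^{2a})` for `a ≥ 1`,
with `A, c > 0` (the upper bound is unconditional, T2). -/
theorem weilGroundEnergy_two_sided_of_riemannHypothesis (hRH : _root_.RiemannHypothesis) :
    ∃ A c C : ℝ, 0 < A ∧ 0 < c ∧ ∀ a : ℝ, 1 ≤ a →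
      Real.exp (-Real.exp (A * a)) ≤ weilGroundEnergy a ∧
        weilGroundEnergy a ≤ C * Real.exp (-c * Real.exp (2 * a)) := by
  obtain ⟨A, hA, hlow⟩ := exp_neg_exp_le_weilGroundEnergy_of_riemannHypothesis hRH
  obtain ⟨c, hc, C, hup⟩ := weilGroundEnergy_exp_exp_decay
  exact ⟨A, c, C, hA, hc, fun a ha ↦ ⟨hlow a ha, hup a ha⟩⟩

/-- Arithmetic of the double logarithm: if `0 < e ≤ C exp(−c X)` with `c > 0` and
`2 |log C| ≤ c X`, then `log (c/2) + log X ≤ log (log e⁻¹)` and `0 < log e⁻¹`. -/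
theorem log_log_inv_ge_of_le_exp {e c C X : ℝ} (he : 0 < e) (hc : 0 < c) (hX : 0 < X)
    (hle : e ≤ C * Real.exp (-c * X)) (hbig : 2 * |Real.log C| ≤ c * X) :
    Real.log (c / 2) + Real.log X ≤ Real.log (Real.log e⁻¹) ∧ 0 < Real.log e⁻¹ := by
  have hC : 0 < C := by
    by_contra h
    push Not at h
    have : C * Real.exp (-c * X) ≤ 0 := mul_nonpos_of_nonpos_of_nonneg h (Real.exp_nonneg _)
    linarith
  -- `log e ≤ log C − c X`, so `log e⁻¹ ≥ c X − log C ≥ c X / 2`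
  have h1 : Real.log e ≤ Real.log C + -c * X := by
    have := Real.log_le_log he hle
    rwa [Real.log_mul hC.ne' (Real.exp_pos _).ne', Real.log_exp] at this
  have h2 : c * X / 2 ≤ Real.log e⁻¹ := by
    rw [Real.log_inv]
    have := le_abs_self (Real.log C)
    linarith
  have hpos : 0 < c * X / 2 := by positivity
  refine ⟨?_, lt_of_lt_of_le hpos h2⟩
  calc Real.log (c / 2) + Real.log X = Real.log (c * X / 2) := by
        rw [← Real.log_mul (by positivity) hX.ne']; ring_nf
    _ ≤ Real.log (Real.log e⁻¹) := Real.log_le_log hpos h2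

/-- **RH ⟹ `log log (1/ε(a)) ≍ a`, with slopes `2` and `A`.**  Under RH there are `A > 0`, `K` and
`a₀` such that for every `a ≥ a₀`

  `2a − K ≤ log (log (ε(a))⁻¹) ≤ A a`.

Lower slope: the unconditional upper law T2.  Upper slope: E3 (RH, via the local pair-correlation
rigidity lemma 2k.E and the anticlustering law).  Both logarithms are genuine (`ε(a) > 0` and
`log (ε(a))⁻¹ > 0` in the range). -/
theorem log_log_inv_weilGroundEnergy_of_riemannHypothesis (hRH : _root_.RiemannHypothesis) :
    ∃ A K a₀ : ℝ, 0 < A ∧ ∀ a : ℝ, a₀ ≤ a →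
      0 < weilGroundEnergy a ∧
      2 * a - K ≤ Real.log (Real.log (weilGroundEnergy a)⁻¹) ∧
        Real.log (Real.log (weilGroundEnergy a)⁻¹) ≤ A * a := by
  obtain ⟨A, c, C, hA, hc, h⟩ := weilGroundEnergy_two_sided_of_riemannHypothesis hRH
  refine ⟨A, -Real.log (c / 2), max 1 (|Real.log C| / c), hA, fun a ha ↦ ?_⟩
  have ha1 : 1 ≤ a := le_trans (le_max_left _ _) ha
  have ha2 : |Real.log C| / c ≤ a := le_trans (le_max_right _ _) ha
  obtain ⟨hlow, hup⟩ := h a ha1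
  have hε : 0 < weilGroundEnergy a := lt_of_lt_of_le (Real.exp_pos _) hlow
  have hX : 0 < Real.exp (2 * a) := Real.exp_pos _
  have hbig : 2 * |Real.log C| ≤ c * Real.exp (2 * a) := by
    have h1 : |Real.log C| ≤ c * a := by rwa [div_le_iff₀ hc, mul_comm] at ha2
    have h2 : 2 * a ≤ Real.exp (2 * a) := by linarith [Real.add_one_le_exp (2 * a)]
    nlinarith
  obtain ⟨hlog, hpos⟩ := log_log_inv_ge_of_le_exp hε hc hX hup hbig
  rw [Real.log_exp] at hlog
  refine ⟨hε, by linarith, ?_⟩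
  -- upper: `ε ≥ exp(−exp(A a))` gives `log ε⁻¹ ≤ exp(A a)`, then take logarithms once more
  have h3 : Real.log (weilGroundEnergy a)⁻¹ ≤ Real.exp (A * a) := by
    rw [Real.log_inv, neg_le, ← Real.log_exp (-Real.exp (A * a))]
    exact Real.log_le_log (Real.exp_pos _) hlow
  calc Real.log (Real.log (weilGroundEnergy a)⁻¹)
      ≤ Real.log (Real.exp (A * a)) := Real.log_le_log hpos h3
    _ = A * a := Real.log_exp _

end Summit.RiemannHypothesis.RiemannHypothesis.Theorems

end
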